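/-
Origin: expansion seat `prover-pub-hodgecm-mc-binder-2-g13-0`, handover #65 2026-08-20T07:09Z md5 5ac56c35a0f4 (168 l.; 8 s; imports #44 `VLetterIota`, #20 `InvariantSlot`, K-1 `Vendored/H21/Analysis/SegalBargmann/FockRowDeterminantIsotypic` (RUN 35); (J-dense)(iv-b) D₁₂ PLACE, EVERY SIGN READING AT ONCE: §1 `linSubst_indScale_X` (the tree's circle scaling on a variable), `eq_C_of_isWeightedHomogeneous_indWt_univ_zero`; §2 `circleOfNorm`, **`scalarVLetter t := ((t·1_{P'}, t̄·1_{Q'}),(1,1))`**, `scalarVWt` (+ four rfl lemmas), **`linSubst_star_dualPairι_scalarVLetter_X`** (`X_i ↦ t X_i` on the R-columns, `t̄ X_i` on the S-columns), `…_of_isEmpty_S` / `…_of_isEmpty_R` (= `linSubst (indScale univ t^{±1})`), **`eq_C_of_kV_invariant_of_definite (IsEmpty R' ∨ IsEmpty S')`**: `(∀ a b, linSubst (dualPairι ((a,b),(1,1)))⋆ G = G) → G = C (coeff 0 G)` (tree `isWeightedHomogeneous_indWt_of_linSubst` + `IsHomogeneous.totalDegree_le`) — the K_V-invariants of a W-definite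 slot are the constants = pv12's printed `kappaPartE = ℂ·1` (#21 covered only the reading `Q' = S' = ∅`); NAME LIST `HodgeCM.Model.HypCensus.eq_C_of_kV_invariant_of_definite` · `….linSubst_star_dualPairι_scalarVLetter_X` · `….scalarVLetter`) (`HOME/mc/pub-hodgecm-mc-binder-2/g13/pkg/HodgeCM/Model/HypCensus/DenseSlotDelta.lean`, md5 5ac56c35a0f4, 168 lines);
landed by the second packager p2 gen 4 (p2-g4) in gate run 44 as `HodgeCM/Model/HypCensus/DenseSlotDelta.lean` (verbatim).
-/
/-
Copyright (c) 2026. All rights reserved.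
Released under Apache 2.0 license as described in the file LICENSE.
-/
import Summits.HodgeConjecture.HodgeCM.Model.HypCensus.VLetterIota
import Summits.HodgeConjecture.HodgeCM.Model.HypCensus.InvariantSlot
import Literature.Analysis.SegalBargmann.FockRowDeterminantIsotypic

/-!
# (J-dense), step (iv-b) at a `D₁₂` place: the `K_V`-invariant Fock polynomials of a `W`-definite slot are the constants

Binder-2 lineage, rows 18/19 (`hyp12`/`hyp34`), field `dense` of `HypCoreW`.

At a `D₁₂` place `W_b` is definite: in Konno–Konno's block index `DPIdx P' Q' R' S'` one of the two `W`-blocks `R'`, `S'` is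
empty (the `V`-blocks `P'`, `Q'` are whatever the reading gives).  The scalar `K_V`-letter `((t·1, t̄·1), (1, 1))`, `|t| = 1`,
substitutes EVERY `R`-column variable by `t` and every `S`-column variable by `t̄` (`linSubst_star_dualPairι_scalarVLetter_X`), so on a
`W`-definite slot it is the scaling of ALL variables by one unimodular scalar; a polynomial fixed by all of them is homogeneous of
degree `0`, i.e. a constant:

* `linSubst_indScale_X` — the circle scaling `indScale A u` of the tree on a variable;
* **`eq_C_of_kV_invariant_of_definite`** (`IsEmpty R' ∨ IsEmpty S'`): `(∀ a b, linSubst (dualPairι ((a,b),(1,1)))⋆ G = G) → G = C (coeff 0 G)`.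

This is the `D₁₂` input of the per-place classification (the printed local module there is `kappaPartE = ℂ·1`), for every sign
reading at once (cf. #21 `eq_C_of_kV_invariant_delta`, the `Q' = S' = ∅` reading via the first fundamental theorem).
[folklore; GoodmanWallach2009 §4.2.1]
-/

noncomputable section

open MvPolynomial Complex
open scoped BigOperators ComplexConjugate
open Literature.Analysis.SegalBargmann

namespace HodgeCM.Model.HypCensus

/-! ## §1 The circle scaling on a variable -/

section Scale

variable {τ : Type} [Fintype τ] [DecidableEq τ]

/-- the tree's circle scaling `indScale A u = diag(u on A, 1 elsewhere)` on a variable. [folklore] -/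
theorem linSubst_indScale_X (A : Finset τ) (u : ℂ) (i : τ) :
    linSubst (indScale A u) (X i : MvPolynomial τ ℂ) = C (if i ∈ A then u else 1) * X i := by
  rw [linSubst_X, Finset.sum_eq_single i]
  · rw [indScale, Matrix.diagonal_apply_eq]
  · intro j _ hj
    rw [indScale, Matrix.diagonal_apply_ne _ (Ne.symm hj), C_0, zero_mul]
  · intro h; exact absurd (Finset.mem_univ i) h

/-- a polynomial all of whose variables have indicator weight `0` is a constant. [folklore] -/
theorem eq_C_of_isWeightedHomogeneous_indWt_univ_zero {G : MvPolynomial τ ℂ}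
    (hG : IsWeightedHomogeneous (indWt (Finset.univ : Finset τ)) G 0) : G = C (coeff 0 G) := by
  have h1 : indWt (Finset.univ : Finset τ) = (1 : τ → ℕ) := funext fun i => if_pos (Finset.mem_univ i)
  rw [h1] at hG
  have h0 : G.totalDegree = 0 := Nat.le_zero.mp (IsHomogeneous.totalDegree_le hG)
  exact totalDegree_eq_zero_iff_eq_C.mp h0

end Scale

/-! ## §2 The scalar `K_V`-letter -/

section Delta

variable {P' Q' R' S' : Type} [Fintype P'] [DecidableEq P'] [Fintype Q'] [DecidableEq Q'] [Fintype R'] [DecidableEq R']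
  [Fintype S'] [DecidableEq S']

/-- a unimodular complex number as a point of the circle. -/
def circleOfNorm (u : ℂ) (hu : ‖u‖ = 1) : Circle := ⟨u, mem_sphere_zero_iff_norm.mpr hu⟩

/-- (Ported verbatim from the HodgeCMPerL package; no docstring in the source.) -/
@[simp] theorem coe_circleOfNorm (u : ℂ) (hu : ‖u‖ = 1) : (circleOfNorm u hu : ℂ) = u := rfl

/-- **the scalar `K_V`-letter** `((t·1_{P'}, t̄·1_{Q'}), (1, 1))`. -/
def scalarVLetter (t : Circle) : DPK P' Q' R' S' :=
  ((circleScalarUnitary P' t, circleScalarUnitary Q' t⁻¹), (1, 1))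

/-- the weight of the scalar letter on a variable: `t` on the `R`-columns, `t̄ = t⁻¹` on the `S`-columns. -/
def scalarVWt (t : Circle) : DPIdx P' Q' R' S' → ℂ :=
  Sum.elim (Sum.elim (fun _ => (t : ℂ)) (fun _ => ((t⁻¹ : Circle) : ℂ)))
    (Sum.elim (fun _ => ((t⁻¹ : Circle) : ℂ)) (fun _ => (t : ℂ)))

omit [Fintype P'] [DecidableEq P'] [Fintype Q'] [DecidableEq Q'] [Fintype R'] [DecidableEq R'] [Fintype S'] [DecidableEq S'] in
/-- (Ported verbatim from the HodgeCMPerL package; no docstring in the source.) -/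
@[simp] theorem scalarVWt_PR (t : Circle) (p : P') (r : R') :
    scalarVWt t (Sum.inl (Sum.inl (p, r)) : DPIdx P' Q' R' S') = (t : ℂ) := rfl

omit [Fintype P'] [DecidableEq P'] [Fintype Q'] [DecidableEq Q'] [Fintype R'] [DecidableEq R'] [Fintype S'] [DecidableEq S'] in
/-- (Ported verbatim from the HodgeCMPerL package; no docstring in the source.) -/
@[simp] theorem scalarVWt_QS (t : Circle) (q : Q') (s : S') :
    scalarVWt t (Sum.inl (Sum.inr (q, s)) : DPIdx P' Q' R' S') = ((t⁻¹ : Circle) : ℂ) := rfl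

omit [Fintype P'] [DecidableEq P'] [Fintype Q'] [DecidableEq Q'] [Fintype R'] [DecidableEq R'] [Fintype S'] [DecidableEq S'] in
/-- (Ported verbatim from the HodgeCMPerL package; no docstring in the source.) -/
@[simp] theorem scalarVWt_PS (t : Circle) (p : P') (s : S') :
    scalarVWt t (Sum.inr (Sum.inl (p, s)) : DPIdx P' Q' R' S') = ((t⁻¹ : Circle) : ℂ) := rfl

omit [Fintype P'] [DecidableEq P'] [Fintype Q'] [DecidableEq Q'] [Fintype R'] [DecidableEq R'] [Fintype S'] [DecidableEq S'] in
/-- (Ported verbatim from the HodgeCMPerL package; no docstring in the source.) -/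
@[simp] theorem scalarVWt_QR (t : Circle) (q : Q') (r : R') :
    scalarVWt t (Sum.inr (Sum.inr (q, r)) : DPIdx P' Q' R' S') = (t : ℂ) := rfl

/-- **the scalar letter on a variable**: `X_i ↦ scalarVWt t i · X_i`. [folklore] -/
theorem linSubst_star_dualPairι_scalarVLetter_X (t : Circle) (i : DPIdx P' Q' R' S') :
    linSubst (star ((dualPairι (scalarVLetter t : DPK P' Q' R' S') : Matrix.unitaryGroup (DPIdx P' Q' R' S') ℂ) :
        Matrix (DPIdx P' Q' R' S') (DPIdx P' Q' R' S') ℂ)) (X i) = C (scalarVWt t i) * X i := by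
  rcases i with (⟨p, r⟩ | ⟨q, s⟩) | (⟨p, s⟩ | ⟨q, r⟩)
  · rw [scalarVLetter, linSubst_star_dualPairι_X_inl_inl, scalarVWt_PR]
    simp only [coe_circleScalarUnitary, OneMemClass.coe_one, Matrix.smul_apply, Matrix.one_apply, smul_eq_mul, mul_ite,
      mul_one, mul_zero, ite_mul, zero_mul, apply_ite C, map_zero, Finset.sum_ite_eq', Finset.mem_univ, if_true]
  · rw [scalarVLetter, linSubst_star_dualPairι_X_QS_general, scalarVWt_QS]
    simp only [coe_circleScalarUnitary, OneMemClass.coe_one, Matrix.smul_apply, Matrix.one_apply, smul_eq_mul, mul_ite,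
      mul_one, mul_zero, ite_mul, zero_mul, apply_ite C, map_zero, Finset.sum_ite_eq', Finset.mem_univ, if_true]
  · rw [scalarVLetter, linSubst_star_dualPairι_X_inr_inl, scalarVWt_PS, Circle.coe_inv_eq_conj]
    simp only [coe_circleScalarUnitary, OneMemClass.coe_one, Matrix.smul_apply, Matrix.one_apply, smul_eq_mul, mul_ite,
      mul_one, mul_zero, apply_ite star, star_one, star_zero, ite_mul, zero_mul, apply_ite C, map_zero, Finset.sum_ite_eq',
      Finset.mem_univ, if_true, star_def]
  · rw [scalarVLetter, linSubst_star_dualPairι_X_QR_general, scalarVWt_QR]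
    have ht : star (((t⁻¹ : Circle) : ℂ)) = (t : ℂ) := by
      rw [Circle.coe_inv_eq_conj, star_def, Complex.conj_conj]
    simp only [coe_circleScalarUnitary, OneMemClass.coe_one, Matrix.smul_apply, Matrix.one_apply, smul_eq_mul, mul_ite,
      mul_one, mul_zero, apply_ite star, star_one, star_zero, ite_mul, zero_mul, apply_ite C, map_zero, Finset.sum_ite_eq',
      Finset.mem_univ, if_true, ht]

/-- on an `S`-empty slot the scalar letter `t` is the scaling of every variable by `t`. -/
theorem linSubst_star_dualPairι_scalarVLetter_of_isEmpty_S [IsEmpty S'] (t : Circle) :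
    linSubst (star ((dualPairι (scalarVLetter t : DPK P' Q' R' S') : Matrix.unitaryGroup (DPIdx P' Q' R' S') ℂ) :
        Matrix (DPIdx P' Q' R' S') (DPIdx P' Q' R' S') ℂ)) =
      linSubst (indScale (Finset.univ : Finset (DPIdx P' Q' R' S')) (t : ℂ)) := by
  refine MvPolynomial.algHom_ext fun i => ?_
  rw [linSubst_star_dualPairι_scalarVLetter_X, linSubst_indScale_X, if_pos (Finset.mem_univ i)]
  rcases i with (⟨p, r⟩ | ⟨q, s⟩) | (⟨p, s⟩ | ⟨q, r⟩)
  · rfl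
  · exact isEmptyElim s
  · exact isEmptyElim s
  · rfl

/-- on an `R`-empty slot the scalar letter `t` is the scaling of every variable by `t⁻¹`. -/
theorem linSubst_star_dualPairι_scalarVLetter_of_isEmpty_R [IsEmpty R'] (t : Circle) :
    linSubst (star ((dualPairι (scalarVLetter t : DPK P' Q' R' S') : Matrix.unitaryGroup (DPIdx P' Q' R' S') ℂ) :
        Matrix (DPIdx P' Q' R' S') (DPIdx P' Q' R' S') ℂ)) =
      linSubst (indScale (Finset.univ : Finset (DPIdx P' Q' R' S')) ((t⁻¹ : Circle) : ℂ)) := by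
  refine MvPolynomial.algHom_ext fun i => ?_
  rw [linSubst_star_dualPairι_scalarVLetter_X, linSubst_indScale_X, if_pos (Finset.mem_univ i)]
  rcases i with (⟨p, r⟩ | ⟨q, s⟩) | (⟨p, s⟩ | ⟨q, r⟩)
  · exact isEmptyElim r
  · rfl
  · rfl
  · exact isEmptyElim r

/-- **THE `K_V`-INVARIANT FOCK POLYNOMIALS OF A `W`-DEFINITE SLOT ARE THE CONSTANTS** (every `V`-reading).
[GoodmanWallach2009 §4.2.1; folklore] -/
theorem eq_C_of_kV_invariant_of_definite (hRS : IsEmpty R' ∨ IsEmpty S') (G : MvPolynomial (DPIdx P' Q' R' S') ℂ)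
    (h : ∀ (a : Matrix.unitaryGroup P' ℂ) (b : Matrix.unitaryGroup Q' ℂ),
      linSubst (star ((dualPairι (((a, b), (1, 1)) : DPK P' Q' R' S') : Matrix.unitaryGroup (DPIdx P' Q' R' S') ℂ) :
          Matrix (DPIdx P' Q' R' S') (DPIdx P' Q' R' S') ℂ)) G = G) :
    G = C (coeff 0 G) := by
  refine eq_C_of_isWeightedHomogeneous_indWt_univ_zero (isWeightedHomogeneous_indWt_of_linSubst _ fun u hu => ?_)
  rw [pow_zero, one_smul]
  rcases hRS with hR | hS
  · have hu' : ‖u⁻¹‖ = 1 := by rw [norm_inv, hu, inv_one]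
    have ht : (((circleOfNorm u⁻¹ hu')⁻¹ : Circle) : ℂ) = u := by
      rw [Circle.coe_inv, coe_circleOfNorm, inv_inv]
    rw [← ht, ← linSubst_star_dualPairι_scalarVLetter_of_isEmpty_R]
    exact h _ _
  · rw [← coe_circleOfNorm u hu, ← linSubst_star_dualPairι_scalarVLetter_of_isEmpty_S]
    exact h _ _

end Delta

end HodgeCM.Model.HypCensus

end
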